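import Literature.MathematicalPhysics.QuantumFieldTheory.Balaban1983to89.B9Eq3132Ineq2142Covariant

/-!
# `Balaban1983to89.B6AvgWeightsKLevelV1` — T. Bałaban, *Propagators and renormalization transformations for lattice gauge theories. I*, Commun. Math. Phys.
# **95** (1984) 17–40 [Balaban1984PropagatorsI], (1.11) p. 19 ∕ (1.18) p. 20 with [Balaban1984PropagatorsII] (2.20) p. 226: THE AVERAGING WEIGHTS `q_y(f)` OF AN
# INDEX BOND IN BLOCK COORDINATES — the straight-tube count is the TENT `(u+1)·L^{−j(D+1)}` on the first block and `(Lʲ−1−u)·L^{−j(D+1)}` on the second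
# block (`u` = the offset of the fine bond along the bond's direction inside its `j`-block), zero off the direction — r03's `qwt` evaluated

statement-level skeleton of published theorems with citation tags; proofs where landed; nothing here is a claim about the Yang–Mills mass gap

THE PRINT.  [3] p. 20, (1.18): *«(Q_kA)(b) = Σ_{x∈B^k(b₋)} L^{−k(d+1)} A([x, x(b)]) … [x, x(b)] is the straight contour from x to x(b) = x + Lᵏe_μ»*, the `k`-fold iterate of
the one-step average (1.11) *«(QA)(c) = Σ_{x∈B(c₋)} L^{−(d+1)} A([x, x(c)])»* (r03's `bondAvgIter_eq_blockSum`, typed as `B6Ineq2142KLevelV1.QE_apply_eq_sum ∕ qwt_eq_sum`: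
`q_y(f) = L^{−j(D+1)}·#{(x, t) : x ∈ Bʲ(y₋), t < Lʲ, [x + te_μ, x + (t+1)e_μ] = f}`); [4] (2.20) p. 226 (the multi-scale `Q`).  The evaluation of the count — a fine bond `f` of
direction `μ` with source at `μ`-offset `u` inside its `j`-block is the `t`-th bond of the contour from `x = f₋ − te_μ`, which lies in `Bʲ(y₋)` for `t ≤ u` if `f₋ ∈ Bʲ(y₋)`
and for `u < t < Lʲ` if `f₋ ∈ Bʲ(y₊)` — is the TENT PROFILE of the written repair's Lemma W (`QGQ-inverse-proof.md` §5.2), which print uses without comment.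

WHY THIS FILE (dag-n06-i gen 13, N06 bundle F4, row 26).  The row-26 coercivity binder `hcoA` (Λ²-coercivity of `Q G₀(U) Q*`, `B9Eq3132CoerciveFromGA`) is, by
`B9Eq3132CoerciveVariational.hcoA_of_testFamily`, ROW 17's `hΔA` plus a test family with (P′2) (approximate right inverse of `Q(U)`) and (P′1) (energy).  The explicit test
family lives on the far ∕ near `μ`-layers of the blocks of an index bond, and (P′2) is the flat combinatorics of the weights `q_y(f)` there: this file supplies the weights in
block coordinates (the sequel classifies which index bonds see which layers and assembles (P′2)).

WHAT IS PROVED (sorry-free; general `P : Params` for the lattice half, r03's `domT` census for the weights).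
* §1 the straight contour in block coordinates: `muOff` (the `μ`-offset `(x_μ) mod Lʲ` inside the `j`-block), `backSite` (`x − te_μ`), `runSite_backSite ∕ backSite_runSite`,
  `muOff_lt`, `muOff_runSite` (`Lʲ ∣ N₀`: `BIJ88BlockCentredWeight.pow_dvd_sitesPerDir` is the same fact, not restated), ★ `iterBlockOf_runSite_apply_self` (the `μ`-label of the `j`-block of `x + te_μ` is that of `x` plus `⌊(u+t)∕Lʲ⌋`), `iterBlockOf_runSite_apply_ne`,
  ★ `iterBlockOf_backSite_apply_self` (the `μ`-label of the block of `x − te_μ`, `t ≤ Lʲ`, is that of `x` minus `[u < t]`), `iterBlockOf_backSite_apply_ne`, `one_ne_zero_sites`.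
* §2 the weights: ★ `qwt_eq_card` (`q_y(f) = L^{−j(D+1)}·#{t < Lʲ : f₋ − te_μ ∈ Bʲ(y₋)}` for `f` of direction `μ = dir y`), `qwt_eq_zero_of_dir_ne`,
  ★★ `qwt_eq_of_src_block` (`f₋ ∈ Bʲ(y₋)`, direction `μ` ⇒ `q_y(f) = L^{−j(D+1)}·(u+1)`), ★★ `qwt_eq_of_tgt_block` (`f₋ ∈ Bʲ(y₊)` ⇒ `q_y(f) = L^{−j(D+1)}·(Lʲ−1−u)`),
  `qwt_eq_zero_of_block_ne` (neither block ⇒ `0`), and the bounds `qwt_le_of_src_block ∕ qwt_ge_of_src_block`-type corollaries used by the sequel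
  (`(1−ε)`-far layer: `q_y(f) ≥ (1−ε)L^{−jD}`; seen from the predecessor: `≤ εL^{−jD}`).

HONEST SCOPE.  Elementary lattice combinatorics of [3] (1.18) on r03's carriers; nothing of [B9]'s estimates; count-neutral; NOT a node discharge.  Cell `pub-ymgap` (HUMAN RULING
D-0062), Track A node N06 [B9], seat `pub-ymgap-dag-n06-i` (gen 13), 2026-08-27; a NEW file.
-/

noncomputable section

namespace Literature.MathematicalPhysics.QuantumFieldTheory.Balaban1983to89.B6AvgWeightsKLevelV1

open Finset LatticeFieldCalculus
open B5Eq118OneStroke (iterBlockOf iterBlock mem_iterBlock val_iterBlockOf)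
open B6AgreeQaQV1Chart (sitesPerDir_zero_eq_mul)

/-! ## §1 The straight contour in block coordinates -/

section Lattice

variable {P : Params}

/-- the `μ`-OFFSET of a fine site inside its `j`-block: `(x_μ) mod Lʲ` (blocks are `⌊label∕Lʲ⌋`, `val_iterBlockOf`). [cite: Balaban1984PropagatorsI, (1.6) p.18, dictionary] -/
def muOff (j : ℕ) (x : Site P 0) (μ : Fin P.d) : ℕ := (x μ).val % P.L ^ j

/-- `u < Lʲ`. [cite: Balaban1984PropagatorsI, (1.6) p.18, bookkeeping] -/
theorem muOff_lt (j : ℕ) (x : Site P 0) (μ : Fin P.d) : muOff j x μ < P.L ^ j := Nat.mod_lt _ (pow_pos P.L_pos j)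

/-- `x − te_μ` (the start of the straight contour of length `t` ending at `x`). [cite: Balaban1984PropagatorsI, (1.7) p.18, dictionary] -/
def backSite (x : Site P 0) (μ : Fin P.d) (t : ℕ) : Site P 0 := Function.update x μ (x μ - t)

/-- `(x − te_μ) + te_μ = x`. [cite: Balaban1984PropagatorsI, (1.7) p.18, bookkeeping] -/
theorem runSite_backSite (x : Site P 0) (μ : Fin P.d) (t : ℕ) : runSite (backSite x μ t) μ t = x := by
  funext ν
  by_cases h : ν = μ
  · subst h; simp [runSite, backSite]
  · simp [runSite, backSite, Function.update_of_ne h]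

/-- `(x + te_μ) − te_μ = x`. [cite: Balaban1984PropagatorsI, (1.7) p.18, bookkeeping] -/
theorem backSite_runSite (x : Site P 0) (μ : Fin P.d) (t : ℕ) : backSite (runSite x μ t) μ t = x := by
  funext ν
  by_cases h : ν = μ
  · subst h; simp [runSite, backSite]
  · simp [runSite, backSite, Function.update_of_ne h]

/-- `x + te_μ = z ⟺ x = z − te_μ`. [cite: Balaban1984PropagatorsI, (1.7) p.18, bookkeeping] -/
theorem runSite_eq_iff (x z : Site P 0) (μ : Fin P.d) (t : ℕ) : runSite x μ t = z ↔ x = backSite z μ t := by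
  constructor
  · rintro rfl; exact (backSite_runSite x μ t).symm
  · rintro rfl; exact runSite_backSite z μ t

/-- the `μ`-coordinate along the contour: `((x + te_μ)_μ).val = (x_μ.val + t) mod N₀`. [cite: Balaban1984PropagatorsI, (1.7) p.18, bookkeeping] -/
theorem val_runSite_self (x : Site P 0) (μ : Fin P.d) (t : ℕ) : ((runSite x μ t) μ).val = ((x μ).val + t) % P.sitesPerDir 0 := by
  simp only [runSite, Function.update_self]
  rw [ZMod.val_add, ZMod.val_natCast, Nat.add_mod_mod]

/-- the other coordinates are constant along the contour. [cite: Balaban1984PropagatorsI, (1.7) p.18, bookkeeping] -/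
theorem runSite_apply_ne (x : Site P 0) {μ ν : Fin P.d} (h : ν ≠ μ) (t : ℕ) : (runSite x μ t) ν = x ν := by
  simp only [runSite, Function.update_of_ne h]

/-- the offset along the contour: `u(x + te_μ) = (u(x) + t) mod Lʲ`. [cite: Balaban1984PropagatorsI, (1.7) p.18, bookkeeping] -/
theorem muOff_runSite {j : ℕ} (hj : j ≤ P.m + P.K) (x : Site P 0) (μ : Fin P.d) (t : ℕ) :
    muOff j (runSite x μ t) μ = (muOff j x μ + t) % P.L ^ j := by
  unfold muOff
  rw [val_runSite_self, Nat.mod_mod_of_dvd _ ⟨P.sitesPerDir j, sitesPerDir_zero_eq_mul P hj⟩, Nat.mod_add_mod]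

/-- ★ **THE BLOCK LABEL ALONG THE CONTOUR**: the `μ`-label of the `j`-block of `x + te_μ` is that of `x` plus `⌊(u(x)+t)∕Lʲ⌋` (as residues).
[cite: Balaban1984PropagatorsI, (1.6) p.18, (1.18) p.20 («x(b) is a point in Bᵏ(b₊)»)] -/
theorem iterBlockOf_runSite_apply_self {j : ℕ} (hj : j ≤ P.m + P.K) (x : Site P 0) (μ : Fin P.d) (t : ℕ) :
    (iterBlockOf j (runSite x μ t)) μ = (iterBlockOf j x) μ + (((muOff j x μ + t) / P.L ^ j : ℕ) : ZMod (P.sitesPerDir j)) := by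
  set q := P.L ^ j with hq
  have hq0 : 0 < q := pow_pos P.L_pos j
  have hN : P.sitesPerDir 0 = q * P.sitesPerDir j := sitesPerDir_zero_eq_mul P hj
  have key : ∀ n : ℕ, n % P.sitesPerDir 0 / q = (n / q) % P.sitesPerDir j := fun n => by rw [hN, Nat.mod_mul_right_div_self]
  have h1 := val_iterBlockOf (P := P) j hj (runSite x μ t) μ
  rw [val_runSite_self, key] at h1
  have h2 := val_iterBlockOf (P := P) j hj x μ
  -- `(v + t)/q = v/q + (v % q + t)/q`
  have h3 : ((x μ).val + t) / q = (x μ).val / q + ((x μ).val % q + t) / q := by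
    conv_lhs => rw [← Nat.div_add_mod (x μ).val q, add_assoc, Nat.mul_add_div hq0]
  rw [← ZMod.natCast_zmod_val ((iterBlockOf j (runSite x μ t)) μ), h1, ZMod.natCast_mod, h3, Nat.cast_add,
    ← h2, ZMod.natCast_zmod_val]
  rfl

/-- the other labels of the block are constant along the contour. [cite: Balaban1984PropagatorsI, (1.6) p.18, bookkeeping] -/
theorem iterBlockOf_runSite_apply_ne {j : ℕ} (hj : j ≤ P.m + P.K) (x : Site P 0) {μ ν : Fin P.d} (h : ν ≠ μ) (t : ℕ) :
    (iterBlockOf j (runSite x μ t)) ν = (iterBlockOf j x) ν := by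
  apply ZMod.val_injective
  rw [val_iterBlockOf j hj, val_iterBlockOf j hj, runSite_apply_ne x h]

/-- ★ **THE BLOCK LABEL BACKWARDS ALONG THE CONTOUR**: for `t ≤ Lʲ`, the `μ`-label of the `j`-block of `x − te_μ` is that of `x` minus `1` if the offset `u(x) < t`, else
unchanged. [cite: Balaban1984PropagatorsI, (1.6) p.18, (1.18) p.20] -/
theorem iterBlockOf_backSite_apply_self {j : ℕ} (hj : j ≤ P.m + P.K) (x : Site P 0) (μ : Fin P.d) {t : ℕ} (ht : t ≤ P.L ^ j) :
    (iterBlockOf j (backSite x μ t)) μ = (iterBlockOf j x) μ - (if muOff j x μ < t then 1 else 0) := by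
  set z := backSite x μ t with hz
  have hx : runSite z μ t = x := runSite_backSite x μ t
  have hlab := iterBlockOf_runSite_apply_self hj z μ t
  have hoff := muOff_runSite hj z μ t
  rw [hx] at hlab hoff
  have huz := muOff_lt j z μ
  -- `(u(z) + t)/Lʲ ∈ {0, 1}` and it is `1` iff `u(x) = u(z) + t − Lʲ < t`
  rw [hlab, eq_comm, add_sub_assoc, add_eq_left, sub_eq_zero]
  by_cases hc : muOff j z μ + t < P.L ^ j
  · rw [Nat.div_eq_of_lt hc, Nat.cast_zero]
    rw [hoff, Nat.mod_eq_of_lt hc, if_neg (by omega)]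
  · push Not at hc
    have h1 : (muOff j z μ + t) / P.L ^ j = 1 :=
      Nat.div_eq_of_lt_le (by rw [one_mul]; exact hc) (by omega)
    rw [h1, Nat.cast_one, hoff]
    have h2 : (muOff j z μ + t) % P.L ^ j = muOff j z μ + t - P.L ^ j := by
      rw [Nat.mod_eq_sub_mod hc, Nat.mod_eq_of_lt (by omega)]
    rw [h2, if_pos (by omega)]

/-- the other labels backwards along the contour are unchanged. [cite: Balaban1984PropagatorsI, (1.6) p.18, bookkeeping] -/
theorem iterBlockOf_backSite_apply_ne {j : ℕ} (hj : j ≤ P.m + P.K) (x : Site P 0) {μ ν : Fin P.d} (h : ν ≠ μ) (t : ℕ) :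
    (iterBlockOf j (backSite x μ t)) ν = (iterBlockOf j x) ν := by
  have := iterBlockOf_runSite_apply_ne hj (backSite x μ t) h t
  rw [runSite_backSite] at this
  exact this.symm

/-- `1 ≠ 0` among the labels of the sites of `T^{(j)}` (every direction has at least two sites). [cite: Balaban1984PropagatorsII, (2.1) p.224, bookkeeping] -/
theorem one_ne_zero_sites (j : ℕ) : (1 : ZMod (P.sitesPerDir j)) ≠ 0 := by
  haveI : Fact (1 < P.sitesPerDir j) := ⟨by
    unfold Params.sitesPerDir
    have := pow_pos P.L_pos (P.m + P.K - j)
    omega⟩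
  exact one_ne_zero

end Lattice

/-! ## §2 The weights `q_y(f)` of an index bond in block coordinates ([3] (1.18) counted) -/

section Weights

open Node00 (IBondY FBondY)
open B6KLevelCensusIndexV1 (KIdx)
open B6Ineq2142KLevelV1 (qwt qwt_eq_sum qwt_nonneg cQ cQ_pos cQ_eq lvl lvl_le_mK)
open B6GlobalChartV1 (PV)

variable {d ℓ : ℕ} {hd : 1 ≤ d + 1} {hL : Odd (ℓ + 1) ∧ 1 < ℓ + 1} {b₀ b₁ : ℝ} (i : KIdx d ℓ hd hL b₀ b₁)

open Classical in
/-- ★ **THE WEIGHT AS A COUNT OVER THE CONTOUR PARAMETER**: for a fine bond `f` of direction `dir y`,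
`q_y(f) = L^{−j(D+1)}·#{t < Lʲ : f₋ − te_μ ∈ Bʲ(y₋)}` (each `t` has exactly one candidate start `x = f₋ − te_μ`). [cite: Balaban1984PropagatorsI, (1.18) p.20] -/
theorem qwt_eq_card (y : IBondY i) (f : FBondY i) (hdir : f.dir = y.1.2.dir) :
    qwt i.hN i.D i.hk y f = cQ (d := d) (ℓ := ℓ) (lvl i.hN i.D i.hk y) *
      (((Finset.range ((ℓ + 1) ^ (lvl i.hN i.D i.hk y))).filter fun t =>
        iterBlockOf (lvl i.hN i.D i.hk y) (backSite f.src y.1.2.dir t) = y.1.2.src).card : ℝ) := by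
  rw [qwt_eq_sum, Finset.sum_comm]
  congr 1
  rw [Finset.card_filter]
  push_cast
  refine Finset.sum_congr rfl fun t _ => ?_
  -- the inner sum over `x ∈ Bʲ(y₋)` picks the single start `x = f₋ − te_μ`
  have hrun : ∀ x : Site (PV d ℓ i.m i.K hd hL) 0, (runBond x y.1.2.dir t = f) ↔ x = backSite f.src y.1.2.dir t := by
    intro x
    rw [← runSite_eq_iff]
    constructor
    · intro h; rw [← h]; rfl
    · intro h
      cases f with
      | mk src dir =>
        simp only at hdir h
        subst hdir
        rw [runBond, h]
  have hfilter : (iterBlock (lvl i.hN i.D i.hk y) y.1.2.src).filter (fun x => runBond x y.1.2.dir t = f) =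
      (iterBlock (lvl i.hN i.D i.hk y) y.1.2.src).filter (fun x => x = backSite f.src y.1.2.dir t) :=
    Finset.filter_congr fun x _ => hrun x
  rw [Finset.sum_boole, hfilter, Finset.filter_eq']
  by_cases hmem : backSite f.src y.1.2.dir t ∈ iterBlock (lvl i.hN i.D i.hk y) y.1.2.src
  · rw [if_pos hmem, Finset.card_singleton, if_pos ((mem_iterBlock _ _ _).1 hmem), Nat.cast_one]
  · rw [if_neg hmem, Finset.card_empty, if_neg (fun h => hmem ((mem_iterBlock _ _ _).2 h)), Nat.cast_zero]

/-- **THE WEIGHT VANISHES OFF THE DIRECTION OF THE BOND**. [cite: Balaban1984PropagatorsI, (1.18) p.20] -/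
theorem qwt_eq_zero_of_dir_ne (y : IBondY i) (f : FBondY i) (hdir : f.dir ≠ y.1.2.dir) : qwt i.hN i.D i.hk y f = 0 := by
  rw [qwt_eq_sum]
  refine mul_eq_zero_of_right _ (Finset.sum_eq_zero fun x _ => Finset.sum_eq_zero fun t _ => ?_)
  rw [if_neg]
  intro h
  apply hdir
  rw [← h]
  rfl

/-- the standing range at an index bond: `j(y) ≤ m + K` for the member's torus. [cite: Balaban1984PropagatorsII, (2.1) p.224, bookkeeping] -/
theorem lvl_le_mK' (y : IBondY i) : lvl i.hN i.D i.hk y ≤ (PV d ℓ i.m i.K hd hL).m + (PV d ℓ i.m i.K hd hL).K := lvl_le_mK i.hN i.D i.hk y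

/-- the member's `L` is `ℓ + 1`. [cite: Balaban1984PropagatorsII, (2.1) p.224, bookkeeping] -/
theorem PV_L : (PV d ℓ i.m i.K hd hL).L = ℓ + 1 := rfl

open Classical in
/-- ★★ **THE WEIGHT ON THE FIRST BLOCK IS THE RISING TENT**: for `f` of direction `μ = dir y` with `f₋ ∈ Bʲ(y₋)` at `μ`-offset `u`, `q_y(f) = L^{−j(D+1)}·(u + 1)`
(the starts `f₋ − te_μ`, `t ≤ u`, lie in `Bʲ(y₋)`; for `u < t < Lʲ` they lie in the preceding block). [cite: Balaban1984PropagatorsI, (1.18) p.20, (1.11) p.19] -/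
theorem qwt_eq_of_src_block (y : IBondY i) (f : FBondY i) (hdir : f.dir = y.1.2.dir)
    (hblk : iterBlockOf (lvl i.hN i.D i.hk y) f.src = y.1.2.src) :
    qwt i.hN i.D i.hk y f = cQ (d := d) (ℓ := ℓ) (lvl i.hN i.D i.hk y) * ((muOff (lvl i.hN i.D i.hk y) f.src y.1.2.dir : ℝ) + 1) := by
  set j := lvl i.hN i.D i.hk y with hj
  set μ := y.1.2.dir with hμ
  set u := muOff j f.src μ with hu
  have hjm : j ≤ (PV d ℓ i.m i.K hd hL).m + (PV d ℓ i.m i.K hd hL).K := lvl_le_mK' i y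
  have huL : u < (ℓ + 1) ^ j := by have := muOff_lt j f.src μ; rwa [PV_L] at this
  rw [qwt_eq_card i y f hdir]
  congr 1
  have hset : ((Finset.range ((ℓ + 1) ^ j)).filter fun t => iterBlockOf j (backSite f.src μ t) = y.1.2.src) = Finset.range (u + 1) := by
    ext t
    simp only [Finset.mem_filter, Finset.mem_range]
    constructor
    · rintro ⟨ht, hb⟩
      by_contra hut
      have htu : u < t := by omega
      have h1 := iterBlockOf_backSite_apply_self hjm f.src μ (t := t) (by rw [PV_L]; exact ht.le)
      rw [hb, ← hblk, if_pos htu] at h1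
      exact one_ne_zero_sites (P := PV d ℓ i.m i.K hd hL) j (sub_eq_self.mp h1.symm)
    · intro ht
      refine ⟨by omega, ?_⟩
      funext ν
      by_cases hν : ν = μ
      · subst hν
        rw [iterBlockOf_backSite_apply_self hjm f.src _ (by rw [PV_L]; omega), if_neg (by omega), sub_zero, hblk]
      · rw [iterBlockOf_backSite_apply_ne hjm f.src hν, hblk]
  rw [hset, Finset.card_range, Nat.cast_add, Nat.cast_one]

open Classical in
/-- ★★ **THE WEIGHT ON THE SECOND BLOCK IS THE FALLING TENT**: for `f` of direction `μ = dir y` with `f₋ ∈ Bʲ(y₊)` at `μ`-offset `u`, `q_y(f) = L^{−j(D+1)}·(Lʲ − 1 − u)`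
(the starts `f₋ − te_μ` lie in `Bʲ(y₋)` exactly for `u < t < Lʲ`). [cite: Balaban1984PropagatorsI, (1.18) p.20, (1.11) p.19] -/
theorem qwt_eq_of_tgt_block (y : IBondY i) (f : FBondY i) (hdir : f.dir = y.1.2.dir)
    (hblk : iterBlockOf (lvl i.hN i.D i.hk y) f.src = y.1.2.tgt) :
    qwt i.hN i.D i.hk y f = cQ (d := d) (ℓ := ℓ) (lvl i.hN i.D i.hk y) *
      ((((ℓ + 1) ^ (lvl i.hN i.D i.hk y) : ℕ) : ℝ) - 1 - (muOff (lvl i.hN i.D i.hk y) f.src y.1.2.dir : ℝ)) := by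
  set j := lvl i.hN i.D i.hk y with hj
  set μ := y.1.2.dir with hμ
  set u := muOff j f.src μ with hu
  have hjm : j ≤ (PV d ℓ i.m i.K hd hL).m + (PV d ℓ i.m i.K hd hL).K := lvl_le_mK' i y
  have huL : u < (ℓ + 1) ^ j := by have := muOff_lt j f.src μ; rwa [PV_L] at this
  rw [qwt_eq_card i y f hdir]
  congr 1
  have htgt : ∀ ν, y.1.2.tgt ν = if ν = μ then y.1.2.src μ + 1 else y.1.2.src ν := by
    intro ν
    by_cases hν : ν = μ
    · subst hν
      rw [if_pos rfl]
      exact Function.update_self _ _ _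
    · rw [if_neg hν]
      exact Function.update_of_ne hν _ _
  have hset : ((Finset.range ((ℓ + 1) ^ j)).filter fun t => iterBlockOf j (backSite f.src μ t) = y.1.2.src) = Finset.Ioo u ((ℓ + 1) ^ j) := by
    ext t
    simp only [Finset.mem_filter, Finset.mem_range, Finset.mem_Ioo]
    constructor
    · rintro ⟨ht, hb⟩
      refine ⟨?_, ht⟩
      by_contra hut
      have h1 := iterBlockOf_backSite_apply_self hjm f.src μ (t := t) (by rw [PV_L]; exact ht.le)
      rw [hb, hblk, htgt μ, if_pos rfl, if_neg hut, sub_zero] at h1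
      exact one_ne_zero_sites (P := PV d ℓ i.m i.K hd hL) j (add_eq_left.mp h1.symm)
    · rintro ⟨hut, ht⟩
      refine ⟨ht, ?_⟩
      funext ν
      by_cases hν : ν = μ
      · subst hν
        rw [iterBlockOf_backSite_apply_self hjm f.src _ (by rw [PV_L]; exact ht.le), if_pos hut, hblk, htgt, if_pos rfl, add_sub_cancel_right]
      · rw [iterBlockOf_backSite_apply_ne hjm f.src hν, hblk, htgt ν, if_neg hν]
  rw [hset, Nat.card_Ioo]
  have : u + 1 ≤ (ℓ + 1) ^ j := huL
  push_cast [Nat.sub_sub, Nat.cast_sub this]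
  ring

/-- **THE WEIGHT VANISHES OFF THE DOUBLE BLOCK** (contrapositive of r03's support lemma). [cite: Balaban1984PropagatorsI, (1.18) p.20] -/
theorem qwt_eq_zero_of_block_ne (y : IBondY i) (f : FBondY i) (h₁ : iterBlockOf (lvl i.hN i.D i.hk y) f.src ≠ y.1.2.src)
    (h₂ : iterBlockOf (lvl i.hN i.D i.hk y) f.src ≠ y.1.2.tgt) : qwt i.hN i.D i.hk y f = 0 := by
  by_contra hne
  rcases B9Eq3132Ineq2142Covariant.ends_of_qwt_ne_zero i hne with h | h
  · exact h₁ h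
  · exact h₂ h

/-- `cQ j · Lʲ = L^{−jD}` (the plateau value of the tent = the flat average weight). [cite: Balaban1984PropagatorsI, (1.18) p.20, bookkeeping] -/
theorem cQ_mul_pow (j : ℕ) : cQ (d := d) (ℓ := ℓ) j * (((ℓ + 1 : ℕ) : ℝ) ^ j) = ((((ℓ + 1 : ℕ) : ℝ) ^ (d + 1)) ^ j)⁻¹ := by
  unfold cQ
  have h : (((ℓ + 1 : ℕ) : ℝ) ^ j) ≠ 0 := by positivity
  rw [mul_assoc, inv_mul_cancel₀ h, mul_one]

/-- **ON THE FAR `(1−ε)`-LAYER OF THE FIRST BLOCK THE WEIGHT IS AT LEAST `(1−ε)L^{−jD}`**: `u + 1 ≥ (1−ε)Lʲ` ⇒ `q_y(f) ≥ (1−ε)·L^{−jD}`.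
[cite: Balaban1984PropagatorsI, (1.18) p.20] -/
theorem qwt_ge_of_far (y : IBondY i) (f : FBondY i) (hdir : f.dir = y.1.2.dir)
    (hblk : iterBlockOf (lvl i.hN i.D i.hk y) f.src = y.1.2.src) {ε : ℝ}
    (hfar : (1 - ε) * (((ℓ + 1 : ℕ) : ℝ) ^ (lvl i.hN i.D i.hk y)) ≤ (muOff (lvl i.hN i.D i.hk y) f.src y.1.2.dir : ℝ) + 1) :
    (1 - ε) * ((((ℓ + 1 : ℕ) : ℝ) ^ (d + 1)) ^ (lvl i.hN i.D i.hk y))⁻¹ ≤ qwt i.hN i.D i.hk y f := by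
  rw [qwt_eq_of_src_block i y f hdir hblk, ← cQ_mul_pow, mul_comm (1 - ε), mul_assoc]
  exact mul_le_mul_of_nonneg_left (by rw [mul_comm]; exact hfar) (cQ_pos _).le

/-- **SEEN FROM THE PREDECESSOR, THE FAR LAYER HAS WEIGHT AT MOST `εL^{−jD}`**: if `f₋` lies in the SECOND block of `y′` at offset `u` with `u + 1 ≥ (1−ε)Lʲ`, then
`q_{y′}(f) ≤ ε·L^{−jD}`. [cite: Balaban1984PropagatorsI, (1.18) p.20] -/
theorem qwt_le_of_far_tgt (y' : IBondY i) (f : FBondY i) (hdir : f.dir = y'.1.2.dir)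
    (hblk : iterBlockOf (lvl i.hN i.D i.hk y') f.src = y'.1.2.tgt) {ε : ℝ}
    (hfar : (1 - ε) * (((ℓ + 1 : ℕ) : ℝ) ^ (lvl i.hN i.D i.hk y')) ≤ (muOff (lvl i.hN i.D i.hk y') f.src y'.1.2.dir : ℝ) + 1) :
    qwt i.hN i.D i.hk y' f ≤ ε * ((((ℓ + 1 : ℕ) : ℝ) ^ (d + 1)) ^ (lvl i.hN i.D i.hk y'))⁻¹ := by
  rw [qwt_eq_of_tgt_block i y' f hdir hblk, ← cQ_mul_pow, mul_comm ε, mul_assoc]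
  refine mul_le_mul_of_nonneg_left ?_ (cQ_pos _).le
  push_cast at hfar ⊢
  have e : (1 - ε) * ((ℓ : ℝ) + 1) ^ (lvl i.hN i.D i.hk y') = ((ℓ : ℝ) + 1) ^ (lvl i.hN i.D i.hk y') - ((ℓ : ℝ) + 1) ^ (lvl i.hN i.D i.hk y') * ε := by
    ring
  linarith

/-- **SEEN FROM A BOND WHOSE SECOND BLOCK CONTAINS `f₋`, THE WEIGHT IS AT MOST THE PLATEAU `L^{−jD}`**. [cite: Balaban1984PropagatorsI, (1.18) p.20] -/
theorem qwt_le_of_tgt_block (y' : IBondY i) (f : FBondY i) (hdir : f.dir = y'.1.2.dir)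
    (hblk : iterBlockOf (lvl i.hN i.D i.hk y') f.src = y'.1.2.tgt) :
    qwt i.hN i.D i.hk y' f ≤ ((((ℓ + 1 : ℕ) : ℝ) ^ (d + 1)) ^ (lvl i.hN i.D i.hk y'))⁻¹ := by
  rw [qwt_eq_of_tgt_block i y' f hdir hblk, ← cQ_mul_pow]
  refine mul_le_mul_of_nonneg_left ?_ (cQ_pos _).le
  have : (0 : ℝ) ≤ (muOff (lvl i.hN i.D i.hk y') f.src y'.1.2.dir : ℝ) := Nat.cast_nonneg _
  push_cast
  linarith

/-- **SEEN FROM A BOND WHOSE FIRST BLOCK CONTAINS `f₋` AT OFFSET `u`, THE WEIGHT IS `≤ L^{−j(D+1)}(u+1)`** — in particular at most the plateau.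
[cite: Balaban1984PropagatorsI, (1.18) p.20] -/
theorem qwt_le_of_src_block (y' : IBondY i) (f : FBondY i) (hdir : f.dir = y'.1.2.dir)
    (hblk : iterBlockOf (lvl i.hN i.D i.hk y') f.src = y'.1.2.src) :
    qwt i.hN i.D i.hk y' f ≤ ((((ℓ + 1 : ℕ) : ℝ) ^ (d + 1)) ^ (lvl i.hN i.D i.hk y'))⁻¹ := by
  rw [qwt_eq_of_src_block i y' f hdir hblk, ← cQ_mul_pow]
  refine mul_le_mul_of_nonneg_left ?_ (cQ_pos _).le
  have h := muOff_lt (lvl i.hN i.D i.hk y') f.src y'.1.2.dir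
  rw [PV_L] at h
  exact_mod_cast h

end Weights

end Literature.MathematicalPhysics.QuantumFieldTheory.Balaban1983to89.B6AvgWeightsKLevelV1

end
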